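import Literature.MathematicalPhysics.QuantumFieldTheory.Balaban1983to89.B9Conv348AtOneLettersY

/-!
# `Balaban1983to89.B9Conv348GaugeOrbitAtLettersY` — T. Bałaban, *Propagators for lattice gauge theories in a background field*, Commun. Math. Phys.
# **99** (1985) 389–434 [Balaban1985BackgroundPropagators], rows 15–16 of the N06 knit ON THE GAUGE ORBIT OF THE TRIVIAL BACKGROUND: Theorem 3.2's
# (3.48), read on the inverse ((3.96)) in [4]'s (2.51) block-majorant currency, IS STABLE UNDER `U ↦ U^u` by (3.33) — hence HOLDS at every pure gauge
# `U = 1^u` (u `SU(N)`-valued) for def-Y's genuine letter `L39 = Q′G′²Q′*`, from [4] Prop. 2.3 OF RECORD at `U = 1`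

[4] = T. Bałaban, *Propagators and renormalization transformations for lattice gauge theories. II*, Commun. Math. Phys. **96** (1984) 223–250
[`Balaban1984PropagatorsII`].

statement-level skeleton of published theorems with citation tags; proofs where landed; nothing here is a claim about the Yang–Mills mass gap

THE PRINTED LOCI (verbatim).  [B9] p. 395, (3.28): *«U^u(x, x′) = u(x)U(x, x′)u⁻¹(x′), (R(u)U′)(x, x′) = R(u(x))U′(x, x′)»*; p. 396, (3.33): *«The
equalities (3.31), (3.32) imply further G′(U^u) = R(u)G′(U)R(u⁻¹), R(U^u) = R(u)R(U)R(u⁻¹)»* — whence (def-Y `Node00.OpsYGauge.XY_cov`)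
`(Q′G′²Q′*)(U^u)R(u) = R(u)(Q′G′²Q′*)(U)`; p. 398, Theorem 3.2 (3.48): *«|(Q′(U)G′²(U)Q′\*(U))⁻¹(y, y′)| ≦ B₀(Lʲη)⁻⁴(L^{j′}η)^{−d}e^{−δ₀d(y,y′)}»*;
p. 407, Cor. 3.5: *«for U = 1 these theorems are proved in [4]»*; [4] p. 232, (2.51): *«|(Tλ)(x)| ≦ K(y, y′)|λ|, x ∈ B^j(y), supp λ ⊂ B^{j′}(y′)»* and
(2.52): *«this property is preserved under the composition of operators possessing it»*.

WHY THIS FILE (cell context; referee ref-A's WATCH-JSAT-N06 — the joint satisfiability, at def-Y's instance, of the member-local binders displayed by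
dag-n06-d's N06 certificate — and director-ym's STANDING A6 RULE).  n06-j's `B9Thm39OneCubeReadingAtLettersY` (p547421) reduced rows 15–16's 24 binders
to ONE display, `Conv348Blk` at the one-cube letters («`L39(U)` has a two-sided inverse with block majorant `B₀(Lʲη)⁻⁴e^{−δ₀d}`»), and
`B9Conv348AtOneLettersY` (p548944) PROVED that display at the trivial background `U = 1` on n06-i's faithful block map for every letters family above T8's
threshold.  THIS FILE transports it along the GAUGE ORBIT: for letters whose site transporter obeys the contour law (3.28) and whose `G′` is covariant
(3.33) — def-Y's letters of record do (`parSymY_isGaugeLawS`, `GpY_isCovSiteOpY`) — `Conv348Blk` at `U` implies `Conv348Blk` at `U^u` with the SAME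
rate and the constant multiplied by `(ρ·c_R)²` (`c_R = cR39 basis39`, the coordinate constant of the real basis of `M_N(ℂ)`; `ρ` a bound of `‖R(u(y))·‖` on
the fibre, `ρ = 1` for `SU(N)`-valued `u`).  The mechanism is [4]'s own (2.52): in real coordinates `R(u)` is the BLOCK-DIAGONAL operator
`D = realify39 basis39 (conjY (gBlkY u))`, which has the (2.51)-majorant `diag(ρ·c_R)` w.r.t. every block map factoring through the block coordinate
(`blk39`, `blk39F`), and a diagonal majorant SCALES a majorant under composition; the inverse of `L39(U^u) = D·L39(U)·D⁻¹` is `D·T·D⁻¹`.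
RESULTS.  §1 `hasMajorant_mul_diag` ((2.52) with a diagonal right factor; the left-factor version is the tree's `B6CommutatorZoneKernels.
hasMajorant_diag_mul`), `inverse_transport_diag` (a two-sided inverse with majorant transports along a block-diagonal conjugation); §2 `realify39_conjY_apply`, `abs_realify39_conjY_le`,
★ `hasMajorant_realify39_conjY`, `realify39_conjY_mul_inv`; §3 ★ `L39_gaugeY_mul` ((3.33) for `L39` in real coordinates), ★★ `conv348_oneCube_gaugeY`
(any fibre algebra `𝔸`, any gauge group, any member, any block map through the block coordinate: `Conv348Blk … B₁ δ₁ U → Conv348Blk … ((ρc_R)²B₁) δ₁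
U^u`); §4 at `𝔸 = M_N(ℂ)`, `G = SU(N)`: `norm_R_le_of_mem_specialUnitaryUnits` (`‖R(γ)a‖ ≦ ‖a‖`), ★★ `conv348_oneCubeYF_gaugeY` (the one-cube letters on
the faithful block map: orbit-stable with `B₁ ↦ c_R²B₁`), ★★★ `conv348_oneCubeYF_pureGauge` (`∃ M₁ B₀ δ₀ > 0`, for EVERY lawful∕covariant letters
family, every faithful bond map, every member above `M₁` and EVERY `SU(N)`-valued `u`: `Conv348Blk (oneCubeOps39YF θ M⋆ 𝔏 bI x) B₀ δ₀ (1^u)`),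
★★★ `conv348_oneCubeYF_pureGauge_recordV4` (at def-Y's `lettersYOfRecordV4`: NO covariance binder), ★★ `rows1516_bodies_oneCubeYF_pureGauge_recordV4`
(the four Theorem-3.9 schema bodies of rows 15–16 HOLD on the whole pure-gauge class at the record).

HONEST SCOPE.  The class reached is the GAUGE ORBIT OF `U = 1` (flat backgrounds `1^u`), a sub-class of every (3.35); Theorem 3.2 proper on (3.35) stays
displayed (not in the tree at def-Y's letters); [4] enters only through T8's DISCHARGED torus census (N03's leg h23) inside p548944; exact
finite-dimensional algebra plus one norm estimate (`‖γaγ⁻¹‖ ≦ ‖γ‖‖a‖‖γ⁻¹‖`); NOT a node discharge, NOT summit progress; count-neutral; one finite 𝕋⁴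
programme — nothing continuum, nothing about the mass gap.  Cell `pub-ymgap` (HUMAN RULING D-0062), Track A node N06 [B9], seat `pub-ymgap-dag-n06-j`
(harness re-seat gen 15), 2026-08-27.  No `sorry`, no `axiom`, no `instance`, no `notation`, no `def`.
-/

noncomputable section

namespace Literature.MathematicalPhysics.QuantumFieldTheory.Balaban1983to89.B9Conv348GaugeOrbitAtLettersY

open Literature.MathematicalPhysics.QuantumFieldTheory.Balaban1983to89
open Finset B6RandomWalk B9Thm39Whole B9Thm39WholeBlk B9Thm39ReadingCoords B9Thm39ReadingAtLetters B9Thm39OneCubeReadingAtLettersY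
  B9Conv348AtOneLettersY B9Eq39Adjoint Node00
open B6KLevelCensusIndexV1 B6Geom246MultiLevelBox B6Geom246MultiLevelTorus B6Ineq2142KLevelV1 B6GlobalChartV1 B9PinMembersKLevelV1
  B9PinCarriersKLevelV1 B9PinGeometryKLevelV1 B7Prop2SpecialUnitary B7Prop1Explicit B9Ineq349SiteFromConv348 B9Thm39ReadingFaithful
  B9BackgroundsKLevelV1R B9GeoLemma21KLevelV1

/-! ## §1 [4] (2.52) with a diagonal factor: a block-diagonal operator scales a (2.51)-majorant -/

section Diag

variable {g : B6.Geometry} [DecidableEq g.Site] {X : Type}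

/-- **(2.52) WITH A DIAGONAL RIGHT FACTOR** (the right-factor twin of the tree's `B6CommutatorZoneKernels.hasMajorant_diag_mul`, which is used below
for the left factor): if `T` has the majorant `K` and `D` the diagonal majorant `diag c`, `c ≧ 0`, then `T·D` has the majorant `K·c`.
[cite: Balaban1984PropagatorsII, (2.52) p.232 («preserved under the composition»)] -/
theorem hasMajorant_mul_diag (blk : X → g.Site) {T D : Module.End ℝ (X → ℝ)} {c : ℝ} {K : g.Site → g.Site → ℝ}
    (hT : HasMajorant blk T K) (hD : HasMajorant blk D (fun a b => if a = b then c else 0)) (hc : 0 ≤ c) :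
    HasMajorant blk (T * D) (fun a b => K a b * c) := by
  refine hasMajorant_mono blk (hasMajorant_mul blk hT hD fun a b => ?_) fun a b => le_of_eq ?_
  · split_ifs
    · exact hc
    · exact le_rfl
  · simp only [mul_ite, mul_zero, Finset.sum_ite_eq', Finset.mem_univ, if_true]

/-- **TRANSPORT OF A TWO-SIDED INVERSE WITH MAJORANT ALONG A BLOCK-DIAGONAL CONJUGATION** (the algebra of this file in one place): if `T` inverts `L`
two-sidedly with majorant `K ≧ 0`, `L′·D = D·L`, `D·D′ = 1 = D′·D`, and `D`, `D′` have the diagonal majorants `diag c`, `diag c′` (`c′ ≧ 0`), then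
`D·T·D′` inverts `L′` two-sidedly with majorant `c·K·c′`. [cite: Balaban1984PropagatorsII, (2.51)–(2.52) p.232; Balaban1985BackgroundPropagators, (3.33) p.396 + (3.96) p.411] -/
theorem inverse_transport_diag (blk : X → g.Site) {L L' T D D' : Module.End ℝ (X → ℝ)} {K : g.Site → g.Site → ℝ} {c c' : ℝ}
    (hTL : T * L = 1) (hLT : L * T = 1) (hK : HasMajorant blk T K) (hKnn : ∀ a b, 0 ≤ K a b)
    (hcov : L' * D = D * L) (hDD' : D * D' = 1) (hD'D : D' * D = 1)
    (hD : HasMajorant blk D (fun a b => if a = b then c else 0)) (hD' : HasMajorant blk D' (fun a b => if a = b then c' else 0))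
    (hc' : 0 ≤ c') :
    (D * T * D') * L' = 1 ∧ L' * (D * T * D') = 1 ∧ HasMajorant blk (D * T * D') (fun a b => c * K a b * c') := by
  have hL' : L' = D * L * D' := by
    calc L' = L' * (D * D') := by rw [hDD', mul_one]
      _ = L' * D * D' := by rw [mul_assoc]
      _ = D * L * D' := by rw [hcov]
  refine ⟨?_, ?_, ?_⟩
  · rw [hL']
    calc D * T * D' * (D * L * D') = D * T * (D' * D) * L * D' := by simp only [mul_assoc]
      _ = D * (T * L) * D' := by rw [hD'D, mul_one]; simp only [mul_assoc]
      _ = 1 := by rw [hTL, mul_one, hDD']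
  · rw [hL']
    calc D * L * D' * (D * T * D') = D * L * (D' * D) * T * D' := by simp only [mul_assoc]
      _ = D * (L * T) * D' := by rw [hD'D, mul_one]; simp only [mul_assoc]
      _ = 1 := by rw [hLT, mul_one, hDD']
  · exact hasMajorant_mul_diag blk (B6CommutatorZoneKernels.hasMajorant_diag_mul blk hD hK hKnn) hD' hc'

end Diag

/-! ## §2 `R(u)` in real coordinates is block-diagonal with the (2.51)-majorant `diag(ρ·c_R)` -/

section Conj

variable {𝔸 : Type} [NormedRing 𝔸] [NormedAlgebra ℂ 𝔸]
variable {S κ : Type} [Fintype κ]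

/-- **`R(u)` IN REAL COORDINATES, EVALUATED**: `(realify39 b (conjY γ) μ)(s, c) = (b-coordinate c of R(γ(s))(Σ_{c′} μ(s, c′) • b_{c′}))` — it reads `μ`
only on the fibre `{s} × κ`. [cite: Balaban1985BackgroundPropagators, (3.28) p.395 («(R(u)U′)(x, x′) = R(u(x))U′(x, x′)»), dictionary] -/
theorem realify39_conjY_apply (b : Module.Basis κ ℝ 𝔸) (γ : S → 𝔸ˣ) (μ : S × κ → ℝ) (p : S × κ) :
    realify39 b (conjY γ) μ p = b.repr (R (γ p.1) (∑ c, μ (p.1, c) • b c)) p.2 := by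
  rw [realify39_apply, coordEquiv39_symm_apply, conjY_apply, coordEquiv39_apply]

/-- **THE FIBRE BOUND**: if `‖R(γ(s))a‖ ≦ ρ‖a‖` on the fibre (`ρ ≧ 0`) and `|μ(s, c′)| ≦ M` for all `c′`, then `|(realify39 b (conjY γ) μ)(s, c)| ≦
ρ·c_R·M` with `c_R = cR39 b = ‖coordinates‖·Σ‖b_c‖·|κ|`. [cite: Balaban1985BackgroundPropagators, (3.28) p.395; Balaban1984PropagatorsII, (2.51) p.232, dictionary] -/
theorem abs_realify39_conjY_le [FiniteDimensional ℝ 𝔸] (b : Module.Basis κ ℝ 𝔸) (γ : S → 𝔸ˣ) {ρ : ℝ} (hρ0 : 0 ≤ ρ)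
    (hρ : ∀ (s : S) (a : 𝔸), ‖R (γ s) a‖ ≤ ρ * ‖a‖) (μ : S × κ → ℝ) (p : S × κ) {M : ℝ} (hM : ∀ c, |μ (p.1, c)| ≤ M) :
    |realify39 b (conjY γ) μ p| ≤ ρ * cR39 b * M := by
  rw [realify39_conjY_apply]
  have hcb : 0 ≤ coordBound39 b := norm_nonneg _
  have hbb : 0 ≤ basisBound39 b := Finset.sum_nonneg fun _ _ => norm_nonneg _
  have hsum : ∑ c, |μ (p.1, c)| ≤ Fintype.card κ * M :=
    (Finset.sum_le_sum fun c _ => hM c).trans (by rw [Finset.sum_const, Finset.card_univ, nsmul_eq_mul])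
  calc |b.repr (R (γ p.1) (∑ c, μ (p.1, c) • b c)) p.2|
      ≤ coordBound39 b * ‖R (γ p.1) (∑ c, μ (p.1, c) • b c)‖ := abs_repr_le b _ _
    _ ≤ coordBound39 b * (ρ * ‖∑ c, μ (p.1, c) • b c‖) := mul_le_mul_of_nonneg_left (hρ _ _) hcb
    _ ≤ coordBound39 b * (ρ * (basisBound39 b * ∑ c, |μ (p.1, c)|)) :=
        mul_le_mul_of_nonneg_left (mul_le_mul_of_nonneg_left (norm_sum_smul_basis_le b _) hρ0) hcb
    _ ≤ coordBound39 b * (ρ * (basisBound39 b * (Fintype.card κ * M))) :=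
        mul_le_mul_of_nonneg_left (mul_le_mul_of_nonneg_left (mul_le_mul_of_nonneg_left hsum hbb) hρ0) hcb
    _ = ρ * cR39 b * M := by
        unfold cR39
        ring

/-- ★ **`R(u)` IN REAL COORDINATES HAS THE DIAGONAL (2.51)-MAJORANT `diag(ρ·c_R)`** with respect to EVERY block map factoring through the block
coordinate (`blk(s, c) = f(s)`: the record's `blk39 = rep39 ∘ fst`, n06-i's `blk39F = rep39F ∘ fst`): a function supported in the block `f⁻¹(y′) × κ` and
bounded by `B` is mapped to a function supported in the same block and bounded by `ρ·c_R·B`. [cite: Balaban1984PropagatorsII, (2.51) p.232; Balaban1985BackgroundPropagators, (3.28) p.395 + (3.33) p.396] -/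
theorem hasMajorant_realify39_conjY [FiniteDimensional ℝ 𝔸] {g : B6.Geometry} [DecidableEq g.Site] (f : S → g.Site) (b : Module.Basis κ ℝ 𝔸)
    (γ : S → 𝔸ˣ) {ρ : ℝ} (hρ0 : 0 ≤ ρ) (hρ : ∀ (s : S) (a : 𝔸), ‖R (γ s) a‖ ≤ ρ * ‖a‖) :
    HasMajorant (fun p : S × κ => f p.1) (realify39 b (conjY γ)) (fun a a' : g.Site => if a = a' then ρ * cR39 b else 0) := by
  intro y' μ Bd hμ p
  show |realify39 b (conjY γ) μ p| ≤ (if f p.1 = y' then ρ * cR39 b else 0) * Bd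
  by_cases hp : f p.1 = y'
  · rw [if_pos hp]
    exact abs_realify39_conjY_le b γ hρ0 hρ μ p fun c => hμ.bound (p.1, c) hp
  · rw [if_neg hp, zero_mul, realify39_conjY_apply]
    have h0 : ∀ c, μ (p.1, c) = 0 := fun c => hμ.off (p.1, c) hp
    simp only [h0, zero_smul, Finset.sum_const_zero, R_def, mul_zero, zero_mul, map_zero, Finsupp.coe_zero, Pi.zero_apply, abs_zero,
      le_refl]

/-- `R(u)R(u⁻¹) = 1 = R(u⁻¹)R(u)` in real coordinates. [cite: Balaban1985BackgroundPropagators, (3.31) p.395 («R(u⁻¹)»), bookkeeping] -/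
theorem realify39_conjY_mul_inv (b : Module.Basis κ ℝ 𝔸) (γ : S → 𝔸ˣ) :
    realify39 b (conjY γ) * realify39 b (conjY γ⁻¹) = 1 ∧ realify39 b (conjY γ⁻¹) * realify39 b (conjY γ) = 1 := by
  have h1 : (conjY γ : Module.End ℂ (S → 𝔸)) * conjY γ⁻¹ = 1 := by
    rw [Module.End.mul_eq_comp, ← conjY_mul, mul_inv_cancel, conjY_one]; rfl
  have h2 : (conjY γ⁻¹ : Module.End ℂ (S → 𝔸)) * conjY γ = 1 := by
    rw [Module.End.mul_eq_comp, ← conjY_mul, inv_mul_cancel, conjY_one]; rfl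
  exact ⟨by rw [← realify39_mul, h1, realify39_one], by rw [← realify39_mul, h2, realify39_one]⟩

end Conj

/-! ## §3 (3.33) for `L39` in real coordinates; `Conv348Blk` at the one-cube letters is gauge-orbit stable -/

section Orbit

variable {𝔸 : Type} [NormedRing 𝔸] [NormedAlgebra ℂ 𝔸] [CompleteSpace 𝔸] [FiniteDimensional ℂ 𝔸] {G : Subgroup 𝔸ˣ}
variable {d ℓ : ℕ} {hd : 1 ≤ d + 1} {hL : Odd (ℓ + 1) ∧ 1 < ℓ + 1} {b₀ b₁ : ℝ} {Mstar : ℕ}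

/-- ★ **(3.33) FOR THE LETTER `L39 = Q′G′²Q′*` IN PRINT's UNITS AND REAL COORDINATES**: for a site transporter obeying the contour law (3.28) and a
covariant `G′`, `L39(U^u)·D = D·L39(U)` with `D = realify39 basis39 (conjY (gBlkY u))` (def-Y's `XY_cov`, conjugated into coordinates).
[cite: Balaban1985BackgroundPropagators, (3.33) p.396 + (3.25) p.395 + (3.95) p.411] -/
theorem L39_gaugeY_mul (i : KIdx d ℓ hd hL b₀ b₁) {parS : SiteParY 𝔸 i} {Gp : SiteOpY 𝔸 i} (hS : IsGaugeLawS i parS) (hGp : IsCovSiteOpY i Gp)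
    (g : GaugeY 𝔸 i) (U : CfgY 𝔸 i) :
    L39 i parS Gp (gaugeY i g U) * realify39 (basis39 𝔸) (conjY (gBlkY i g)) =
      realify39 (basis39 𝔸) (conjY (gBlkY i g)) * L39 i parS Gp U := by
  have h : XY i parS Gp (gaugeY i g U) ∘ₗ conjY (gBlkY i g) = conjY (gBlkY i g) ∘ₗ XY i parS Gp U := XY_cov hS hGp
  show realify39 (basis39 𝔸) (((unit39 i : ℝ) : ℂ) • XY i parS Gp (gaugeY i g U)) * realify39 (basis39 𝔸) (conjY (gBlkY i g)) =
    realify39 (basis39 𝔸) (conjY (gBlkY i g)) * realify39 (basis39 𝔸) (((unit39 i : ℝ) : ℂ) • XY i parS Gp U)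
  rw [← realify39_mul, ← realify39_mul, Module.End.mul_eq_comp, Module.End.mul_eq_comp, LinearMap.smul_comp, LinearMap.comp_smul, h]

/-- ★★ **`Conv348Blk` AT THE ONE-CUBE LETTERS IS GAUGE-ORBIT STABLE** (any complete normed finite-dimensional ℂ-algebra `𝔸`, any gauge group, any
member `x`, any block map through the block coordinate): if the site transporter obeys (3.28), `G′` is covariant (3.33), `‖R(u(c_s))·‖, ‖R(u(c_s)⁻¹)·‖ ≦ ρ`
on the fibre (`ρ ≧ 0`), and `L39(U)` has a two-sided inverse with block majorant `B₁(Lʲη)⁻⁴e^{−δ₁d}` (`B₁ ≧ 0`), then `L39(U^u)` has one with block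
majorant `(ρc_R)²B₁(Lʲη)⁻⁴e^{−δ₁d}` — the inverse `D·T·D⁻¹`. [cite: Balaban1985BackgroundPropagators, (3.33) p.396 + Thm 3.2 (3.48) p.398 + (3.96) p.411; Balaban1984PropagatorsII, (2.51)–(2.52) p.232] -/
theorem conv348_oneCube_gaugeY (x : MemberY d ℓ hd hL b₀ b₁ Mstar) [Fintype (geo9Y x).Site] [DecidableEq (geo9Y x).Site]
    (f : BlkY x.toKIdx → (geo9Y x).Site) {parS : SiteParY 𝔸 x.toKIdx} {Gp : SiteOpY 𝔸 x.toKIdx}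
    (hS : IsGaugeLawS x.toKIdx parS) (hGp : IsCovSiteOpY x.toKIdx Gp) (g : GaugeY 𝔸 x.toKIdx) {ρ : ℝ} (hρ0 : 0 ≤ ρ)
    (hρ : ∀ (s : BlkY x.toKIdx) (a : 𝔸), ‖R (gBlkY x.toKIdx g s) a‖ ≤ ρ * ‖a‖)
    (hρ' : ∀ (s : BlkY x.toKIdx) (a : 𝔸), ‖R (gBlkY x.toKIdx g s)⁻¹ a‖ ≤ ρ * ‖a‖)
    {B₁ δ₁ : ℝ} (hB₁ : 0 ≤ B₁) {U : CfgY 𝔸 x.toKIdx}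
    (h : Conv348Blk (oneCubeOps39 (geo9Y x) (bg9Y 𝔸 G x) (fun p : X39 𝔸 x.toKIdx => f p.1) (L39 x.toKIdx parS Gp)) B₁ δ₁ U) :
    Conv348Blk (oneCubeOps39 (geo9Y x) (bg9Y 𝔸 G x) (fun p : X39 𝔸 x.toKIdx => f p.1) (L39 x.toKIdx parS Gp))
      ((ρ * cR39 (basis39 𝔸)) ^ 2 * B₁) δ₁ (gaugeY x.toKIdx g U) := by
  classical
  obtain ⟨T, hTL, hLT, hK⟩ := h
  have hKnn : ∀ a b : (geo9Y x).Site, 0 ≤ B₁ * (geo9Y x).len a ^ (-(4 : ℝ)) * Real.exp (-(δ₁ * (geo9Y x).dist a b)) := fun a b =>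
    mul_nonneg (mul_nonneg hB₁ (Real.rpow_nonneg (geo9Y_len_pos x a).le _)) (Real.exp_pos _).le
  have hD := hasMajorant_realify39_conjY (g := b6 (geo9Y x)) f (basis39 𝔸) (gBlkY x.toKIdx g) hρ0 hρ
  have hD' := hasMajorant_realify39_conjY (g := b6 (geo9Y x)) f (basis39 𝔸) (gBlkY x.toKIdx g)⁻¹ hρ0 fun s a => hρ' s a
  obtain ⟨hDD', hD'D⟩ := realify39_conjY_mul_inv (basis39 𝔸) (gBlkY x.toKIdx g)
  have hc : 0 ≤ ρ * cR39 (basis39 𝔸) := mul_nonneg hρ0 (cR39_nonneg _)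
  obtain ⟨h1, h2, h3⟩ := inverse_transport_diag (g := b6 (geo9Y x)) (fun p : X39 𝔸 x.toKIdx => f p.1) (c := ρ * cR39 (basis39 𝔸))
    (c' := ρ * cR39 (basis39 𝔸)) hTL hLT hK hKnn (L39_gaugeY_mul x.toKIdx hS hGp g U) hDD' hD'D hD hD' hc
  refine ⟨_, h1, h2, hasMajorant_mono _ h3 fun a b => le_of_eq ?_⟩
  ring

end Orbit

/-! ## §4 At def-Y's letters on Stage 3′(Y) (`𝔸 = M_N(ℂ)`, `G = SU(N)`): `(3.48)⁻¹` on the whole pure-gauge orbit -/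

section StageY

open scoped Matrix.Norms.L2Operator

/-- **`R(γ)` IS A CONTRACTION ON `M_N(ℂ)` FOR `γ ∈ SU(N)`** (operator norm): `‖γaγ⁻¹‖ ≦ ‖γ‖‖a‖‖γ⁻¹‖ ≦ ‖a‖` by `SU(N) ⊆ U1` (`‖γ‖, ‖γ⁻¹‖ ≦ 1`); at
`N = 0` both sides vanish. [cite: Balaban1985BackgroundPropagators, (3.28) p.395; Balaban1985Averaging, (19) p.21 («|u| ≦ 1»)] -/
theorem norm_R_le_of_mem_specialUnitaryUnits {N : ℕ} {γ : (Matrix (Fin N) (Fin N) ℂ)ˣ} (hγ : γ ∈ specialUnitaryUnits (Fin N))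
    (a : Matrix (Fin N) (Fin N) ℂ) : ‖R γ a‖ ≤ ‖a‖ := by
  rcases Nat.eq_zero_or_pos N with hN | hN
  · subst hN
    have ha : a = 0 := Subsingleton.elim _ _
    rw [ha, R_def, mul_zero, zero_mul]
  · haveI : Nonempty (Fin N) := ⟨⟨0, hN⟩⟩
    obtain ⟨h1, h2⟩ := (mem_U1 (𝔸 := Matrix (Fin N) (Fin N) ℂ)).1 (specialUnitaryUnits_le_U1 hγ)
    rw [R_def]
    calc ‖(γ : Matrix (Fin N) (Fin N) ℂ) * a * ((γ⁻¹ : (Matrix (Fin N) (Fin N) ℂ)ˣ) : Matrix (Fin N) (Fin N) ℂ)‖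
        ≤ ‖(γ : Matrix (Fin N) (Fin N) ℂ) * a‖ * ‖((γ⁻¹ : (Matrix (Fin N) (Fin N) ℂ)ˣ) : Matrix (Fin N) (Fin N) ℂ)‖ := norm_mul_le _ _
      _ ≤ ‖(γ : Matrix (Fin N) (Fin N) ℂ)‖ * ‖a‖ * ‖((γ⁻¹ : (Matrix (Fin N) (Fin N) ℂ)ˣ) : Matrix (Fin N) (Fin N) ℂ)‖ :=
          mul_le_mul_of_nonneg_right (norm_mul_le _ _) (norm_nonneg _)
      _ ≤ 1 * ‖a‖ * 1 :=
          mul_le_mul (mul_le_mul_of_nonneg_right h1 (norm_nonneg _)) h2 (norm_nonneg _) (mul_nonneg zero_le_one (norm_nonneg _))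
      _ = ‖a‖ := by ring

variable {N : ℕ} (θ : Stage3Params) (Mstar : ℕ)
variable [∀ x : MemberY θ.d₆ θ.ℓ₆ θ.hd' θ.hL' θ.b₀ θ.b₁ Mstar, Fintype (geo9Y x).Site]
  [∀ x : MemberY θ.d₆ θ.ℓ₆ θ.hd' θ.hL' θ.b₀ θ.b₁ Mstar, DecidableEq (geo9Y x).Site]

/-- ★★ **`(3.48)⁻¹` AT THE ONE-CUBE LETTERS ON THE FAITHFUL BLOCK MAP IS GAUGE-ORBIT STABLE at def-Y's instance**: for a letters family whose site
transporter obeys (3.28) and whose `G′` is covariant (3.33) at the member `x`, and an `SU(N)`-valued gauge function `u`: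
`Conv348Blk (oneCubeOps39YF θ M⋆ 𝔏 bI x) B₁ δ₁ U → Conv348Blk (oneCubeOps39YF θ M⋆ 𝔏 bI x) (c_R²·B₁) δ₁ U^u` (`c_R = cR39 (basis39 M_N(ℂ))`).
[cite: Balaban1985BackgroundPropagators, (3.33) p.396 + Thm 3.2 (3.48) p.398 + (3.96) p.411; Balaban1984PropagatorsII, (2.51)–(2.52) p.232] -/
theorem conv348_oneCubeYF_gaugeY (𝔏 : LettersY N θ Mstar)
    (bI : ∀ x : MemberY θ.d₆ θ.ℓ₆ θ.hd' θ.hL' θ.b₀ θ.b₁ Mstar, FBondY x.toKIdx → IBondY x.toKIdx)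
    (x : MemberY θ.d₆ θ.ℓ₆ θ.hd' θ.hL' θ.b₀ θ.b₁ Mstar) (hS : IsGaugeLawS x.toKIdx (𝔏 x).parS) (hGp : IsCovSiteOpY x.toKIdx (𝔏 x).Gp)
    (u : GaugeY (Matrix (Fin N) (Fin N) ℂ) x.toKIdx) (hu : ∀ y, u y ∈ specialUnitaryUnits (Fin N))
    {B₁ δ₁ : ℝ} (hB₁ : 0 ≤ B₁) {U : CfgY (Matrix (Fin N) (Fin N) ℂ) x.toKIdx}
    (h : Conv348Blk (oneCubeOps39YF θ Mstar 𝔏 bI x) B₁ δ₁ U) :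
    Conv348Blk (oneCubeOps39YF θ Mstar 𝔏 bI x) (cR39 (basis39 (Matrix (Fin N) (Fin N) ℂ)) ^ 2 * B₁) δ₁ (gaugeY x.toKIdx u U) := by
  have hmem : ∀ s : BlkY x.toKIdx, gBlkY x.toKIdx u s ∈ specialUnitaryUnits (Fin N) := fun s => hu _
  have h' := conv348_oneCube_gaugeY (G := specialUnitaryUnits (Fin N)) x (rep39F x.toKIdx (bI x)) hS hGp u zero_le_one
    (fun s a => by rw [one_mul]; exact norm_R_le_of_mem_specialUnitaryUnits (hmem s) a)
    (fun s a => by rw [one_mul]; exact norm_R_le_of_mem_specialUnitaryUnits ((specialUnitaryUnits (Fin N)).inv_mem (hmem s)) a) hB₁ h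
  rw [one_mul] at h'
  exact h'

/-- ★★★ **`(3.48)⁻¹` ON THE WHOLE PURE-GAUGE ORBIT**: there are `M₁, B₀, δ₀ > 0` (functions of `d, L, N`: T8's census constants, the repaired (2.61)
constant, `c_R²`) such that for EVERY letters family `𝔏` whose site transporters obey (3.28) and whose `G′` is covariant (3.33), every level-∕1-faithful
bond map `bI`, every member `x` of Stage 3′(Y) with `M₁ ≦ M`, and EVERY `SU(N)`-valued gauge function `u`:
`Conv348Blk (oneCubeOps39YF θ M⋆ 𝔏 bI x) B₀ δ₀ (1^u)` — the genuine `L39(1^u) = Q′G′²Q′*(1^u)` has a two-sided inverse with the block majorant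
`B₀(Lʲη)⁻⁴e^{−δ₀d}` on the faithful block map.  p548944 at `U = 1` transported by `conv348_oneCubeYF_gaugeY`. [cite: Balaban1985BackgroundPropagators, Thm 3.2 (3.48) p.398 + (3.33)–(3.34) p.396 + Cor. 3.5 p.407 («for U = 1 … proved in [4]»); Balaban1984PropagatorsII, Prop. 2.3 (2.86)–(2.87) p.238 + (2.51)–(2.52) p.232] -/
theorem conv348_oneCubeYF_pureGauge : ∃ M₁ B₀ δ₀ : ℝ, 0 < M₁ ∧ 0 < B₀ ∧ 0 < δ₀ ∧
    ∀ (𝔏 : LettersY N θ Mstar) (_hS : ∀ x : MemberY θ.d₆ θ.ℓ₆ θ.hd' θ.hL' θ.b₀ θ.b₁ Mstar, IsGaugeLawS x.toKIdx (𝔏 x).parS)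
      (_hGp : ∀ x : MemberY θ.d₆ θ.ℓ₆ θ.hd' θ.hL' θ.b₀ θ.b₁ Mstar, IsCovSiteOpY x.toKIdx (𝔏 x).Gp)
      (bI : ∀ x : MemberY θ.d₆ θ.ℓ₆ θ.hd' θ.hL' θ.b₀ θ.b₁ Mstar, FBondY x.toKIdx → IBondY x.toKIdx)
      (_hβ1 : ∀ (x : MemberY θ.d₆ θ.ℓ₆ θ.hd' θ.hL' θ.b₀ θ.b₁ Mstar) (f : FBondY x.toKIdx),
        (geomT x.D).dist (β x.hN x.D x.hk (bI x f)) (blkV1 x.hN x.D f) ≤ 1)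
      (_hlev : ∀ (x : MemberY θ.d₆ θ.ℓ₆ θ.hd' θ.hL' θ.b₀ θ.b₁ Mstar) (f : FBondY x.toKIdx), lvl x.hN x.D x.hk (bI x f) = (blkV1 x.hN x.D f).1.1)
      (x : MemberY θ.d₆ θ.ℓ₆ θ.hd' θ.hL' θ.b₀ θ.b₁ Mstar), M₁ ≤ (geo9Y x).M →
      ∀ u : GaugeY (Matrix (Fin N) (Fin N) ℂ) x.toKIdx, (∀ y, u y ∈ specialUnitaryUnits (Fin N)) →
        Conv348Blk (oneCubeOps39YF θ Mstar 𝔏 bI x) B₀ δ₀ (gaugeY x.toKIdx u (fun _ _ => 1)) := by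
  obtain ⟨M₁, B₀, δ₀, hM₁, hB₀, hδ₀, h⟩ := conv348_oneCubeYF_one (N := N) θ Mstar
  have hc1 : (1 : ℝ) ≤ cR39 (basis39 (Matrix (Fin N) (Fin N) ℂ)) ^ 2 + 1 := by nlinarith [sq_nonneg (cR39 (basis39 (Matrix (Fin N) (Fin N) ℂ)))]
  refine ⟨M₁, (cR39 (basis39 (Matrix (Fin N) (Fin N) ℂ)) ^ 2 + 1) * B₀, δ₀, hM₁, by positivity, hδ₀,
    fun 𝔏 hS hGp bI hβ1 hlev x hM u hu => ?_⟩
  have h1 := conv348_oneCubeYF_gaugeY θ Mstar 𝔏 bI x (hS x) (hGp x) u hu hB₀.le (h 𝔏 bI hβ1 hlev x hM)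
  obtain ⟨T, hTL, hLT, hK⟩ := h1
  refine ⟨T, hTL, hLT, hasMajorant_mono _ hK fun a b => ?_⟩
  have hl : 0 ≤ (geo9Y x).len a ^ (-(4 : ℝ)) := Real.rpow_nonneg (geo9Y_len_pos x a).le _
  have he : 0 ≤ Real.exp (-(δ₀ * (geo9Y x).dist a b)) := (Real.exp_pos _).le
  have hB : cR39 (basis39 (Matrix (Fin N) (Fin N) ℂ)) ^ 2 * B₀ ≤ (cR39 (basis39 (Matrix (Fin N) (Fin N) ℂ)) ^ 2 + 1) * B₀ :=
    mul_le_mul_of_nonneg_right (by linarith) hB₀.le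
  exact mul_le_mul_of_nonneg_right (mul_le_mul_of_nonneg_right hB hl) he

/-- ★★★ **AT def-Y's LETTERS OF RECORD (`lettersYOfRecordV4`), NO COVARIANCE BINDER**: the record's site transporter `parSymY` obeys (3.28)
(`parSymY_isGaugeLawS`) and its `G′ = GpY parSymY` is covariant (`GpY_isCovSiteOpY`), so `(3.48)⁻¹` holds on the whole pure-gauge orbit at the record:
`∃ M₁ B₀ δ₀ > 0, ∀ 𝔯 bI (faithful) x, M₁ ≦ M → ∀ u SU(N)-valued, Conv348Blk (oneCubeOps39YF θ M⋆ (lettersYOfRecordV4 N θ M⋆ 𝔯) bI x) B₀ δ₀ (1^u)`.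
[cite: Balaban1985BackgroundPropagators, Thm 3.2 (3.48) p.398 + (3.33)–(3.34) p.396 + (3.40) p.397 + Cor. 3.5 p.407; Balaban1984PropagatorsII, Prop. 2.3 (2.86)–(2.87) p.238] -/
theorem conv348_oneCubeYF_pureGauge_recordV4 : ∃ M₁ B₀ δ₀ : ℝ, 0 < M₁ ∧ 0 < B₀ ∧ 0 < δ₀ ∧
    ∀ (𝔯 : ResY N θ Mstar) (bI : ∀ x : MemberY θ.d₆ θ.ℓ₆ θ.hd' θ.hL' θ.b₀ θ.b₁ Mstar, FBondY x.toKIdx → IBondY x.toKIdx)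
      (_hβ1 : ∀ (x : MemberY θ.d₆ θ.ℓ₆ θ.hd' θ.hL' θ.b₀ θ.b₁ Mstar) (f : FBondY x.toKIdx),
        (geomT x.D).dist (β x.hN x.D x.hk (bI x f)) (blkV1 x.hN x.D f) ≤ 1)
      (_hlev : ∀ (x : MemberY θ.d₆ θ.ℓ₆ θ.hd' θ.hL' θ.b₀ θ.b₁ Mstar) (f : FBondY x.toKIdx), lvl x.hN x.D x.hk (bI x f) = (blkV1 x.hN x.D f).1.1)
      (x : MemberY θ.d₆ θ.ℓ₆ θ.hd' θ.hL' θ.b₀ θ.b₁ Mstar), M₁ ≤ (geo9Y x).M →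
      ∀ u : GaugeY (Matrix (Fin N) (Fin N) ℂ) x.toKIdx, (∀ y, u y ∈ specialUnitaryUnits (Fin N)) →
        Conv348Blk (oneCubeOps39YF θ Mstar (lettersYOfRecordV4 N θ Mstar 𝔯) bI x) B₀ δ₀ (gaugeY x.toKIdx u (fun _ _ => 1)) := by
  obtain ⟨M₁, B₀, δ₀, hM₁, hB₀, hδ₀, h⟩ := conv348_oneCubeYF_pureGauge (N := N) θ Mstar
  exact ⟨M₁, B₀, δ₀, hM₁, hB₀, hδ₀, fun 𝔯 bI hβ1 hlev x hM u hu =>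
    h (lettersYOfRecordV4 N θ Mstar 𝔯) (fun x => parSymY_isGaugeLawS x.toKIdx) (fun x => GpY_isCovSiteOpY (parSymY_isGaugeLawS x.toKIdx))
      bI hβ1 hlev x hM u hu⟩

/-- ★★ **ROWS 15–16's DISPLAYED ANALYSIS HOLDS ON THE WHOLE PURE-GAUGE CLASS AT THE RECORD**: the four Theorem-3.9 schema bodies of rows 15–16
(`Local348Blk ∧ Identities395Blk ∧ Small285Blk ∧ Factors389Blk`, `θ₀ := 0`, any rate `r`) at the one-cube letters of record on the faithful block map,
for every residual letter `𝔯`, every faithful bond map, every member above the threshold and every pure gauge `1^u` — p547421's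
`schemas39_oneCube_of_conv348` on `conv348_oneCubeYF_pureGauge_recordV4`. [cite: Balaban1985BackgroundPropagators, Thm 3.2 (3.48) p.398 + (3.87) p.409 + (3.95)–(3.96) p.411 + (3.33)–(3.34) p.396; Balaban1984PropagatorsII, Prop. 2.3 (2.86)–(2.87) p.238] -/
theorem rows1516_bodies_oneCubeYF_pureGauge_recordV4 (r : ℝ) : ∃ M₁ B₀ δ₀ : ℝ, 0 < M₁ ∧ 0 < B₀ ∧ 0 < δ₀ ∧
    ∀ (𝔯 : ResY N θ Mstar) (bI : ∀ x : MemberY θ.d₆ θ.ℓ₆ θ.hd' θ.hL' θ.b₀ θ.b₁ Mstar, FBondY x.toKIdx → IBondY x.toKIdx)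
      (_hβ1 : ∀ (x : MemberY θ.d₆ θ.ℓ₆ θ.hd' θ.hL' θ.b₀ θ.b₁ Mstar) (f : FBondY x.toKIdx),
        (geomT x.D).dist (β x.hN x.D x.hk (bI x f)) (blkV1 x.hN x.D f) ≤ 1)
      (_hlev : ∀ (x : MemberY θ.d₆ θ.ℓ₆ θ.hd' θ.hL' θ.b₀ θ.b₁ Mstar) (f : FBondY x.toKIdx), lvl x.hN x.D x.hk (bI x f) = (blkV1 x.hN x.D f).1.1)
      (x : MemberY θ.d₆ θ.ℓ₆ θ.hd' θ.hL' θ.b₀ θ.b₁ Mstar), M₁ ≤ (geo9Y x).M →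
      ∀ u : GaugeY (Matrix (Fin N) (Fin N) ℂ) x.toKIdx, (∀ y, u y ∈ specialUnitaryUnits (Fin N)) →
        Local348Blk (oneCubeOps39YF θ Mstar (lettersYOfRecordV4 N θ Mstar 𝔯) bI x) B₀ δ₀ (gaugeY x.toKIdx u (fun _ _ => 1)) ∧
        Identities395Blk (oneCubeOps39YF θ Mstar (lettersYOfRecordV4 N θ Mstar 𝔯) bI x) (gaugeY x.toKIdx u (fun _ _ => 1)) ∧
        Small285Blk (oneCubeOps39YF θ Mstar (lettersYOfRecordV4 N θ Mstar 𝔯) bI x) 0 r (gaugeY x.toKIdx u (fun _ _ => 1)) ∧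
        Factors389Blk (oneCubeOps39YF θ Mstar (lettersYOfRecordV4 N θ Mstar 𝔯) bI x) 0 δ₀ (gaugeY x.toKIdx u (fun _ _ => 1)) := by
  classical
  obtain ⟨M₁, B₀, δ₀, hM₁, hB₀, hδ₀, h⟩ := conv348_oneCubeYF_pureGauge_recordV4 (N := N) θ Mstar
  refine ⟨M₁, B₀, δ₀, hM₁, hB₀, hδ₀, fun 𝔯 bI hβ1 hlev x hM u hu => ?_⟩
  exact schemas39_oneCube_of_conv348 _ _ r le_rfl (geo9Y_M_nonneg θ Mstar x) (h 𝔯 bI hβ1 hlev x hM u hu)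

end StageY

end Literature.MathematicalPhysics.QuantumFieldTheory.Balaban1983to89.B9Conv348GaugeOrbitAtLettersY

end
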